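import Mathlib
import Summits.QuantumFields.QCD.Theses.MultibosonBridge
import Summits.QuantumFields.QCD.Theorems.MultibosonBridgeAdmissibleRootsBinomialTail
import Summits.QuantumFields.QCD.Theorems.MultibosonBridgeAdmissibleRootsChebyshevSquare
import Summits.QuantumFields.QCD.Theorems.MultibosonBridgeAdmissibleRootsEstimates

/-!
# `MultibosonBridge.AdmissibleRootsExistR` (item stmt-QuantumFields-10699) — proof

The two-interval approximation with a gap asked for by route MultibosonBridge (QCD sub-problem):
for `0 < ε < 1`, `0 < δ < 1`, `c > 0`, `ℓ` with `ε ℓ² ≥ 64` there are `κ > 0` and a list `l` of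
at most `ℓ log(2/δ)` NON-REAL complex numbers with `|t| κ ∏_{z ∈ l} |t - z|² ∈ [1 - δ, 1 + δ]`
for `√ε c ≤ |t| ≤ c` and `≤ 1 + δ` for `|t| ≤ √ε c`.

## Construction (different from the planner's Chebyshev-interpolation "Construction M"; chosen for
## elementary formalisation)

With `x = t/c`, `s = x²`, `y = (1 + ε - 2s)/(1 - ε)`, `r = √ε`, `ρ = (1 - r)/(1 + r)`: for
`s ∈ [ε, 1]`, `y = cos θ ∈ [-1, 1]` and `z = ρ e^{iθ}` has `|1 - z| = 2x/(1 + r)`. The binomial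
series `f(z) = (1 - z)^{-1/4} = Σ b_n z^n` has `|f(z)|⁴ = (1 + r)/(2x)`; its truncation
`f_m(z) = Σ_{n ≤ m} b_n z^n` satisfies `|f_m(z)|² = Q(y)` for the real polynomial
`Q = Σ_{j,k ≤ m} b_j b_k ρ^{j+k} T_{j-k}` of degree `m` (Chebyshev `T`). So the real polynomial
`A(t) = Q(y(t²/c²))` of degree `2m` has `x · (2/(1+r)) · A² = |f_m/f|⁴ ∈ [(1-η)⁴, (1+η)⁴]` with
`η = 2ρ^{m+1}` (Abel tail bound + `b_{m+1} ≤ (m+2)^{-3/4}`, helper file *BinomialTail*), while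
on the gap `x (2/(1+r)) A² ≤ 1` (termwise positivity at `y = cosh u`, helper file
*ChebyshevSquare*). Finally `q = (2/((1+r)c)) (A² + δ/8) = κ ∏ |t - z|²` over the roots of the
complex polynomial `A + i√(δ/8)`, none of which is real. With `m + 1 = ⌈log(16/δ)/√ε⌉` one has
`η ≤ δ/8` and `2m ≤ ℓ log(2/δ)`.

Main theorem: `Summit.QuantumFields.QCD.Theorems.MultibosonBridge.admissibleRootsExistR_proof`.
No named facts; axioms standard. Nothing about QCD or Yang–Mills themselves is proved here: this
is the approximation-theoretic support item of the route only.
-/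

noncomputable section

open scoped BigOperators ComplexConjugate
open Complex Finset Polynomial

namespace Summit.QuantumFields.QCD.Theorems.MultibosonBridge.AdmissibleRoots

/-! ### A positive real polynomial plus a constant as `κ ∏ |x - z|²` over non-real roots -/

/-- For a real polynomial `A` and `T > 0`, the function `A(x)² + T` is `κ ∏_{z ∈ l} |x - z|²`
for some `κ > 0` and a list `l` of at most `deg A` complex numbers, none real (the roots of
`A + i√T`). -/
theorem exists_roots_sq_add (A : ℝ[X]) {T : ℝ} (hT : 0 < T) :
    ∃ (κ : ℝ) (l : List ℂ), 0 < κ ∧ l.length ≤ A.natDegree ∧ (∀ z ∈ l, z.im ≠ 0) ∧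
      ∀ x : ℝ, κ * (l.map fun z => ‖(x : ℂ) - z‖ ^ 2).prod = (A.eval x) ^ 2 + T := by
  set τ := Real.sqrt T with hτ
  have hτpos : 0 < τ := Real.sqrt_pos.mpr hT
  have hτsq : τ ^ 2 = T := Real.sq_sqrt hT.le
  set F : ℂ[X] := A.map Complex.ofRealHom + C ((τ : ℂ) * I) with hF
  -- evaluation at real points
  have hFeval : ∀ x : ℝ, F.eval (x : ℂ) = ((A.eval x : ℝ) : ℂ) + (τ : ℂ) * I := by
    intro x
    rw [hF, eval_add, eval_C, eval_map, ← Complex.ofRealHom_eq_coe x, eval₂_hom]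
    rfl
  have hFne : F ≠ 0 := by
    intro h
    have h0 := hFeval 0
    rw [h, eval_zero] at h0
    have := congrArg Complex.im h0
    simp at this
    exact hτpos.ne' this.symm
  -- degree
  have hdeg : F.natDegree ≤ A.natDegree := by
    rw [hF]
    refine (natDegree_add_le _ _).trans ?_
    rw [natDegree_C, Nat.max_zero]
    exact natDegree_map_le
  -- splitting over ℂ
  have hcard : F.roots.card = F.natDegree := IsAlgClosed.card_roots_eq_natDegree
  have hsplit := C_leadingCoeff_mul_prod_multiset_X_sub_C hcard
  set l : List ℂ := F.roots.toList with hl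
  have hlroots : (l : Multiset ℂ) = F.roots := Multiset.coe_toList _
  have hlead : F.leadingCoeff ≠ 0 := leadingCoeff_ne_zero.mpr hFne
  refine ⟨‖F.leadingCoeff‖ ^ 2, l, by positivity, ?_, ?_, ?_⟩
  · rw [hl, Multiset.length_toList, hcard]; exact hdeg
  · intro z hz hzim
    have hz' : z ∈ F.roots := by rw [← hlroots]; exact Multiset.mem_coe.mpr hz
    have hroot : F.eval z = 0 := (mem_roots hFne).mp hz'
    have hzre : z = ((z.re : ℝ) : ℂ) := by
      apply Complex.ext <;> simp [hzim]
    rw [hzre, hFeval] at hroot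
    have := congrArg Complex.im hroot
    simp at this
    exact hτpos.ne' this
  · intro x
    have hprodnorm : ∀ (g : ℂ → ℂ) (l' : List ℂ),
        ‖(l'.map g).prod‖ ^ 2 = (l'.map fun z => ‖g z‖ ^ 2).prod := by
      intro g l'
      induction l' with
      | nil => simp
      | cons a t ih => simp [mul_pow, ih]
    have heval : F.eval (x : ℂ) =
        F.leadingCoeff * (l.map fun z => (x : ℂ) - z).prod := by
      conv_lhs => rw [← hsplit]
      rw [eval_mul, eval_C, eval_multiset_prod, Multiset.map_map, ← hlroots, Multiset.map_coe,
        Multiset.prod_coe]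
      congr 1
      simp [Function.comp_def]
    have hnorm : ‖F.eval (x : ℂ)‖ ^ 2 = (A.eval x) ^ 2 + T := by
      rw [hFeval, Complex.sq_norm, Complex.normSq_add_mul_I, hτsq]
    rw [← hnorm, heval, norm_mul, mul_pow, hprodnorm]

/-! ### Numerical inequalities -/

/-- `(1+η)^4 ≤ 1 + 5η` and `1 - 4η ≤ (1-η)^4` for `0 ≤ η ≤ 1/8`. -/
theorem pow_four_bounds {η : ℝ} (h0 : 0 ≤ η) (h1 : η ≤ 1 / 8) :
    (1 + η) ^ 4 ≤ 1 + 5 * η ∧ 1 - 4 * η ≤ (1 - η) ^ 4 := by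
  constructor
  · nlinarith [mul_nonneg h0 h0, mul_nonneg (mul_nonneg h0 h0) h0,
      mul_nonneg (mul_nonneg h0 h0) (mul_nonneg h0 h0)]
  · nlinarith [mul_nonneg h0 h0, mul_nonneg (mul_nonneg h0 h0) h0,
      mul_nonneg (mul_nonneg h0 h0) (mul_nonneg h0 h0)]

/-- **Parameter choice.** With `m + 1 = ⌈log(16/δ)/√ε⌉`: `(m+1)√ε ≥ 1`, `2ρ^{m+1} ≤ δ/8`
(`ρ = (1-√ε)/(1+√ε) ≤ 1 - √ε ≤ e^{-√ε}`), and `2m ≤ ℓ log(2/δ)` (as `√ε ℓ ≥ 8` and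
`log(16/δ) ≤ 4 log(2/δ)`). -/
theorem exists_params {ε δ : ℝ} {ℓ : ℕ} (hε0 : 0 < ε) (hε1 : ε < 1) (hδ0 : 0 < δ) (hδ1 : δ < 1)
    (hℓ : 64 ≤ ε * (ℓ : ℝ) ^ 2) :
    ∃ m : ℕ, 1 ≤ ((m : ℝ) + 1) * Real.sqrt ε ∧
      2 * ((1 - Real.sqrt ε) / (1 + Real.sqrt ε)) ^ (m + 1) ≤ δ / 8 ∧
      2 * (m : ℝ) ≤ (ℓ : ℝ) * Real.log (2 / δ) := by
  obtain ⟨hr0, hr1⟩ := sqrt_bounds hε0 hε1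
  set r := Real.sqrt ε with hr
  set L := Real.log (16 / δ) with hL
  have h16 : (16 : ℝ) ≤ 16 / δ := by
    rw [le_div_iff₀ hδ0]; nlinarith
  have hL1 : 1 ≤ L := by
    rw [hL, Real.le_log_iff_exp_le (by positivity)]
    have := Real.exp_one_lt_d9
    linarith
  have hLpos : 0 < L := by linarith
  set N := ⌈L / r⌉₊ with hN
  have hNge : L / r ≤ (N : ℝ) := Nat.le_ceil _
  have hNpos : 0 < N := Nat.ceil_pos.mpr (div_pos hLpos hr0)
  have hNlt : (N : ℝ) < L / r + 1 := Nat.ceil_lt_add_one (div_pos hLpos hr0).le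
  refine ⟨N - 1, ?_, ?_, ?_⟩
  · have hcast : (((N - 1 : ℕ) : ℝ) + 1) = N := by
      rw [Nat.cast_sub (by omega)]; push_cast; ring
    rw [hcast]
    have : L ≤ (N : ℝ) * r := by rwa [div_le_iff₀ hr0] at hNge
    linarith
  · have hN1 : N - 1 + 1 = N := Nat.sub_add_cancel hNpos
    rw [hN1]
    obtain ⟨hρ0, _, hρle⟩ := rho_bounds hε0 hε1
    have h1 : ((1 - r) / (1 + r)) ^ N ≤ (Real.exp (-r)) ^ N := by
      apply pow_le_pow_left₀ hρ0
      exact hρle.trans (by linarith [Real.add_one_le_exp (-r)])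
    have h2 : (Real.exp (-r)) ^ N = Real.exp (-(N * r)) := by
      rw [← Real.exp_nat_mul]; ring_nf
    have h3 : Real.exp (-(N * r)) ≤ Real.exp (-L) := by
      rw [Real.exp_le_exp]
      have : L ≤ (N : ℝ) * r := by rwa [div_le_iff₀ hr0] at hNge
      linarith
    have h4 : Real.exp (-L) = δ / 16 := by
      rw [hL, Real.exp_neg, Real.exp_log (by positivity)]
      field_simp
    calc 2 * ((1 - r) / (1 + r)) ^ N ≤ 2 * Real.exp (-L) := by
          linarith [h1.trans (h2.le.trans h3)]
      _ = δ / 8 := by rw [h4]; ring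
  · -- 2m ≤ 2 L / r ≤ L ℓ / 4 ≤ ℓ log (2/δ)
    have hm : ((N - 1 : ℕ) : ℝ) ≤ L / r := by
      rw [Nat.cast_sub (by omega)]; push_cast; linarith
    have hrl : 8 ≤ r * ℓ := by
      have h64 : Real.sqrt 64 ≤ Real.sqrt (ε * (ℓ : ℝ) ^ 2) := Real.sqrt_le_sqrt hℓ
      rw [show (64 : ℝ) = 8 ^ 2 by norm_num, Real.sqrt_sq (by norm_num),
        Real.sqrt_mul hε0.le, Real.sqrt_sq (by positivity)] at h64
      exact h64
    have hlog2 : Real.log 2 ≤ Real.log (2 / δ) := by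
      apply Real.log_le_log (by norm_num)
      rw [le_div_iff₀ hδ0]; nlinarith
    have hLle : L ≤ 4 * Real.log (2 / δ) := by
      have : L = 3 * Real.log 2 + Real.log (2 / δ) := by
        rw [hL, show (16 : ℝ) / δ = 2 ^ 3 * (2 / δ) by ring, Real.log_mul (by norm_num)
          (by positivity), Real.log_pow]
        push_cast; ring
      linarith
    have hLr : L / r ≤ L * ℓ / 8 := by
      rw [div_le_div_iff₀ hr0 (by norm_num)]
      nlinarith
    calc 2 * (((N - 1 : ℕ) : ℝ)) ≤ 2 * (L * ℓ / 8) := by linarith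
      _ = (ℓ : ℝ) * (L / 4) := by ring
      _ ≤ (ℓ : ℝ) * Real.log (2 / δ) := by
          apply mul_le_mul_of_nonneg_left _ (by positivity)
          linarith
/-! ### Assembly -/

/-- The quantity splits as the band/gap term plus a small constant term:
`|t| · (2/((1+r)c)) (Qy² + δ/8) = √s (2/(1+r)) Qy² + (|t|/c)(2/(1+r)) δ/8` with `s = t²/c²`. -/
theorem split_identity {r c δ : ℝ} (hc : 0 < c) (hr : 0 < 1 + r) (t Qy : ℝ) :
    |t| * (2 / ((1 + r) * c) * (Qy ^ 2 + δ / 8)) =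
      Real.sqrt (t ^ 2 / c ^ 2) * (2 / (1 + r)) * Qy ^ 2 + |t| / c * (2 / (1 + r)) * (δ / 8) := by
  rw [Real.sqrt_div (sq_nonneg t), Real.sqrt_sq_eq_abs, Real.sqrt_sq hc.le]
  field_simp

end AdmissibleRoots

open AdmissibleRoots in
/-- **Item stmt-QuantumFields-10699 (`MultibosonBridge.AdmissibleRootsExistR`).** For
`0 < ε < 1`, `0 < δ < 1`, `c > 0` and `ℓ` with `ε ℓ² ≥ 64` there are `κ > 0` and a list `l` of at
most `ℓ log(2/δ)` non-real complex numbers with `|t| κ ∏_{z∈l} |t - z|² ∈ [1 - δ, 1 + δ]` for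
`√ε c ≤ |t| ≤ c` and `≤ 1 + δ` for `|t| ≤ √ε c`. Construction: `l` = roots of `A + i√(δ/8)` where
`A(t) = Q(y(t²/c²))`, `Q = Σ_{j,k≤m} b_j b_k ρ^{j+k} T_{j-k}` the Chebyshev modulus-square of the
truncated binomial series of `(1-z)^{-1/4}` at `z = ρe^{iθ}`, `ρ = (1-√ε)/(1+√ε)`,
`m + 1 = ⌈log(16/δ)/√ε⌉`; see the module docstring. (Support item of route MultibosonBridge;
nothing about QCD itself is proved.) -/
theorem admissibleRootsExistR_proof :
    Summit.QuantumFields.QCD.Theses.MultibosonBridge.AdmissibleRootsExistR := by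
  unfold Summit.QuantumFields.QCD.Theses.MultibosonBridge.AdmissibleRootsExistR
  intro ε δ c ℓ hε0 hε1 hδ0 hδ1 hc hℓ
  obtain ⟨m, hm1, hm2, hm3⟩ := exists_params hε0 hε1 hδ0 hδ1 hℓ
  obtain ⟨hr0, hr1⟩ := sqrt_bounds hε0 hε1
  obtain ⟨hρ0, hρ1, hρle⟩ := rho_bounds hε0 hε1
  set r := Real.sqrt ε with hr
  set ρ := (1 - r) / (1 + r) with hρ
  set w : ℕ → ℝ := fun j => Ring.multichoose (1 / 4 : ℝ) j * ρ ^ j with hw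
  set Q : ℝ[X] := ∑ j ∈ range (m + 1), ∑ k ∈ range (m + 1),
    C (w j * w k) * Chebyshev.T ℝ ((j : ℤ) - k) with hQ
  set A : ℝ[X] := Q.comp (C ((1 + ε) / (1 - ε)) - C (2 / ((1 - ε) * c ^ 2)) * X ^ 2) with hA
  have hT : (0 : ℝ) < δ / 8 := by positivity
  obtain ⟨κA, l, hκA, hlen, him, hprod⟩ := exists_roots_sq_add A hT
  have h1r : 0 < 1 + r := by linarith
  have hη0 : 0 ≤ 2 * ρ ^ (m + 1) := by positivity
  have hη1 : 2 * ρ ^ (m + 1) ≤ 1 / 8 := by linarith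
  obtain ⟨h5, h4⟩ := pow_four_bounds hη0 hη1
  -- evaluation of A
  have heval : ∀ t : ℝ, A.eval t = Q.eval ((1 + ε - 2 * (t ^ 2 / c ^ 2)) / (1 - ε)) := by
    intro t
    rw [hA, eval_comp]
    congr 1
    simp only [eval_sub, eval_mul, eval_C, eval_pow, eval_X]
    have h1 : (1 - ε) ≠ 0 := by linarith
    field_simp
  -- the key identity for the product
  have hkey : ∀ t : ℝ, |t| * (2 / ((1 + r) * c) * κA * (l.map fun z => ‖(t : ℂ) - z‖ ^ 2).prod) =
      Real.sqrt (t ^ 2 / c ^ 2) * (2 / (1 + r)) *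
          (Q.eval ((1 + ε - 2 * (t ^ 2 / c ^ 2)) / (1 - ε))) ^ 2 +
        |t| / c * (2 / (1 + r)) * (δ / 8) := by
    intro t
    rw [mul_assoc (2 / ((1 + r) * c)), hprod t, heval t, split_identity hc h1r]
  -- the small constant term
  have hsmall : ∀ t : ℝ, |t| ≤ c → 0 ≤ |t| / c * (2 / (1 + r)) * (δ / 8) ∧
      |t| / c * (2 / (1 + r)) * (δ / 8) ≤ δ / 4 := by
    intro t ht
    refine ⟨by positivity, ?_⟩
    have h1 : |t| / c ≤ 1 := by rw [div_le_one hc]; exact ht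
    have h2 : 2 / (1 + r) ≤ 2 := by rw [div_le_iff₀ h1r]; linarith
    calc |t| / c * (2 / (1 + r)) * (δ / 8) ≤ 1 * 2 * (δ / 8) := by
          gcongr
      _ = δ / 4 := by ring
  refine ⟨2 / ((1 + r) * c) * κA, l, by positivity, ?_, him, ?_, ?_⟩
  · -- length bound
    have hdegQ : Q.natDegree ≤ m := natDegree_sqPoly_le w m
    have hdeg2 : (C ((1 + ε) / (1 - ε)) - C (2 / ((1 - ε) * c ^ 2)) * X ^ 2 : ℝ[X]).natDegree ≤ 2 := by
      refine (natDegree_sub_le _ _).trans ?_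
      rw [natDegree_C, Nat.zero_max]
      exact natDegree_C_mul_X_pow_le _ _
    have hdegA : A.natDegree ≤ m * 2 := natDegree_comp_le.trans (Nat.mul_le_mul hdegQ hdeg2)
    have hlen' : (l.length : ℝ) ≤ 2 * (m : ℝ) := by
      have : l.length ≤ m * 2 := hlen.trans hdegA
      have := (Nat.cast_le (α := ℝ)).mpr this
      push_cast at this
      linarith
    exact hlen'.trans hm3
  · -- the band √ε c ≤ |t| ≤ c
    intro t ht1 ht2
    have htc : r ≤ |t| / c := by rw [le_div_iff₀ hc]; linarith
    have htc' : |t| / c ≤ 1 := by rw [div_le_one hc]; exact ht2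
    have hs : t ^ 2 / c ^ 2 = (|t| / c) ^ 2 := by rw [div_pow, sq_abs]
    have hs0 : ε ≤ t ^ 2 / c ^ 2 := by
      rw [hs]
      have : r ^ 2 = ε := Real.sq_sqrt hε0.le
      nlinarith
    have hs1 : t ^ 2 / c ^ 2 ≤ 1 := by
      rw [hs]; nlinarith [abs_nonneg t, hc]
    obtain ⟨hlo, hhi⟩ := band_estimate hε0 hε1 m hm1 (by linarith) w (fun j => rfl) hs0 hs1
    obtain ⟨hsm0, hsm1⟩ := hsmall t ht2
    rw [hkey t]
    constructor
    · linarith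
    · linarith
  · -- the gap |t| ≤ √ε c
    intro t ht
    rcases eq_or_ne t 0 with h0 | h0
    · subst h0
      simp only [abs_zero, zero_mul]
      linarith
    · have htpos : 0 < |t| := abs_pos.mpr h0
      have hs : t ^ 2 / c ^ 2 = (|t| / c) ^ 2 := by rw [div_pow, sq_abs]
      have hs0 : 0 < t ^ 2 / c ^ 2 := by positivity
      have hs1 : t ^ 2 / c ^ 2 ≤ ε := by
        rw [hs]
        have h1 : |t| / c ≤ r := by rw [div_le_iff₀ hc]; linarith
        have h2 : 0 ≤ |t| / c := by positivity
        have : r ^ 2 = ε := Real.sq_sqrt hε0.le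
        nlinarith
      have hgap := gap_estimate hε0 hε1 m w (fun j => rfl) hs0 hs1
      have htc : |t| ≤ c := by nlinarith
      obtain ⟨hsm0, hsm1⟩ := hsmall t htc
      rw [hkey t]
      linarith

end Summit.QuantumFields.QCD.Theorems.MultibosonBridge

end
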